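import Literature.AlgebraicGeometry.Motives.MixedHodgeExtensionByTate
import Literature.AlgebraicGeometry.Motives.MixedHodgeExtensionTateNonSeparatedFunctorial
import HarnessLib

/-!
# Duality of extensions is natural: `(f^* x)^∨ = (f^∨)_* x^∨`, `(g_* x)^∨ = (g^∨)^* x^∨`; naturality of `Ext(A, ℚ(m)) ≃ J⁰_W(A^∨(m))`

Carlson, *Extensions of mixed Hodge structures* (1980), §2(b) PROPOSITION 1 ("`Ext` is a functor …
covariant in the sub, contravariant in the quotient") and §2(c) Remark (3) (the dual extension);
Mac Lane, *Homology*, Ch. III §1 (1.2), (1.4'). In the tree, for ARBITRARY finite-dimensional pairs,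
`Ext.dualEquivW : Ext(A, B) ≃ Ext(B^∨, A^∨)`, `[E] ↦ [E^∨]` (`MixedHodgeExtensionDualNonSeparated`),
with the class identities `clsW_dual_pushout`, `clsW_dual_pullback` at the level of extensions.
This file lifts them to the groups `Ext` — **`dualEquivW (f^* x) = (f^∨)_* (dualEquivW x)`**,
**`dualEquivW (g_* x) = (g^∨)^* (dualEquivW x)`** — and deduces the **naturality in `A` of the
classification of extensions by the Tate structures `Ext(A, ℚ(m)) ≃ J⁰_W(A^∨(m))`**
(`MixedHodgeExtensionByTate`): pull-back of extensions along `h : A' → A` corresponds to push-forward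
`(h^∨(m))_* : J⁰_W(A^∨(m)) → J⁰_W(A'^∨(m))` along the transpose (`Ext.tateSubEquivJacobianW_pullbackMapW`,
`Extension.tateSubInvariant_pullback`).

## Main results (all proved; no named facts)

* `Ext.dualEquivW_pullbackMapW`, `Ext.dualEquivW_pushoutMapW`.
* `Ext.tateSubEquivJacobianW_pullbackMapW`, `Extension.tateSubInvariant_pullback`,
  `Extension.tateSubInvariant_pullback_eq_zero_of`, `Extension.isSplit_pullback_of_isSplit_tateSub`.

## References

* [Carlson1980] J. A. Carlson, Extensions of mixed Hodge structures (1980), §2(b) Prop. 1, §2(c)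
  Remark (3) (held text `book:beauvillend-proceedings-indo-french-conference-geometry`, pp. 89, 91).
* [MacLane1963Homology] S. Mac Lane, Homology (1963), Ch. III §1 (1.2), (1.4'), Lemmas 1.2, 1.4.
* [Jannsen1990MixedMotives] U. Jannsen, Mixed Motives and Algebraic K-Theory, LNM 1400, §9 Lemma 9.2.
-/

open scoped TensorProduct

noncomputable section

namespace Literature.AlgebraicGeometry.Motives

namespace MixedHodgeStructure

open HodgeStructure (tate)

universe u u' v v' w

variable {VA : Type u} [AddCommGroup VA] [Module ℚ VA] [FiniteDimensional ℚ VA]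
variable {VA' : Type u'} [AddCommGroup VA'] [Module ℚ VA'] [FiniteDimensional ℚ VA']
variable {VB : Type v} [AddCommGroup VB] [Module ℚ VB] [FiniteDimensional ℚ VB]
variable {VB' : Type v'} [AddCommGroup VB'] [Module ℚ VB'] [FiniteDimensional ℚ VB']
variable {VE : Type w} [AddCommGroup VE] [Module ℚ VE]

/-! ### §1 `dualEquivW` is natural -/

namespace Ext

variable {A : MixedHodgeStructure VA} {A' : MixedHodgeStructure VA'}
variable {B : MixedHodgeStructure VB} {B' : MixedHodgeStructure VB'}

omit [AddCommGroup VB'] [Module ℚ VB'] [FiniteDimensional ℚ VB'] [AddCommGroup VE] [Module ℚ VE] in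
/-- **`(f^* x)^∨ = (f^∨)_* x^∨`**: duality turns pull-back along `f : A' → A` into push-out along the
transpose `f^∨ : A^∨ → A'^∨` (in `Ext`, all pairs). [cite: MacLane1963Homology, Ch. III §1 Lemma 1.2]
[cite: Carlson1980, §2(c) Remark (3)] -/
theorem dualEquivW_pullbackMapW (f : Hom A' A) (x : Ext A B) :
    dualEquivW (pullbackMapW f x) = pushoutMapW f.transpose (dualEquivW x) := by
  apply extEquivJHomW.injective
  rw [extEquivJHomW_apply, clsW_dualEquivW, ← extEquivJHomW_apply, extEquivJHomW_pullbackMapW,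
    JHomW.transposeW_precomp, extEquivJHomW_pushoutMapW, clsW_dualEquivW, map_neg]

omit [AddCommGroup VA'] [Module ℚ VA'] [FiniteDimensional ℚ VA'] [AddCommGroup VE] [Module ℚ VE] in
/-- **`(g_* x)^∨ = (g^∨)^* x^∨`**: duality turns push-out along `g : B → B'` into pull-back along the
transpose `g^∨ : B'^∨ → B^∨`. [cite: MacLane1963Homology, Ch. III §1 Lemma 1.4]
[cite: Carlson1980, §2(c) Remark (3)] -/
theorem dualEquivW_pushoutMapW (g : Hom B B') (x : Ext A B) :
    dualEquivW (pushoutMapW g x) = pullbackMapW g.transpose (dualEquivW x) := by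
  apply extEquivJHomW.injective
  rw [extEquivJHomW_apply, clsW_dualEquivW, ← extEquivJHomW_apply, extEquivJHomW_pushoutMapW,
    JHomW.transposeW_postcomp, extEquivJHomW_pullbackMapW, clsW_dualEquivW, map_neg]

end Ext

/-! ### §2 Naturality of `Ext(A, ℚ(m)) ≃ J⁰_W(A^∨(m))` in `A` -/

section TateSubNaturality

variable {A : MixedHodgeStructure VA} {A' : MixedHodgeStructure VA'} (m : ℤ)

omit [AddCommGroup VB] [Module ℚ VB] [FiniteDimensional ℚ VB] [AddCommGroup VB'] [Module ℚ VB']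
  [FiniteDimensional ℚ VB'] [AddCommGroup VE] [Module ℚ VE] in
/-- **Naturality of `Ext(A, ℚ(m)) ≃ J⁰_W(A^∨(m))`**: for `h : A' → A`,
`tateSubEquivJacobianW A' m (h^* x) = (h^∨(m))_* (tateSubEquivJacobianW A m x)` — pulling an
extension `0 → ℚ(m) → E → A → 0` back along `h` pushes its invariant forward along the twisted
transpose `h^∨(m) : A^∨(m) → A'^∨(m)`. [cite: Carlson1980, §2(b) Prop. 1]
[cite: Jannsen1990MixedMotives, §9 Lemma 9.2] -/
theorem Ext.tateSubEquivJacobianW_pullbackMapW (h : Hom A' A) (x : Ext A (tate m).toMixedHodgeStructure) :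
    Ext.tateSubEquivJacobianW A' m (Ext.pullbackMapW h x) =
      ((h.transpose).tateTwist m).jacobianWMap (Ext.tateSubEquivJacobianW A m x) := by
  rw [Ext.tateSubEquivJacobianW_apply, Ext.tateSubEquivJacobianW_apply, Ext.dualEquivW_pullbackMapW,
    ← Ext.pushoutMapW_pullbackMapW, Ext.tateEquivJacobianW_pushoutMapW]

omit [AddCommGroup VB] [Module ℚ VB] [FiniteDimensional ℚ VB] [AddCommGroup VB'] [Module ℚ VB']
  [FiniteDimensional ℚ VB'] in
/-- **The invariant of a pull-back**: `e(h^* E) = (h^∨(m))_* e(E)` in `J⁰_W(A'^∨(m))`, for an extension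
`0 → ℚ(m) → E → A → 0` on any carrier. [cite: Carlson1980, §2(b) Prop. 1] -/
theorem Extension.tateSubInvariant_pullback (h : Hom A' A) (E : Extension A (tate m).toMixedHodgeStructure VE) :
    (E.pullback h).tateSubInvariant = ((h.transpose).tateTwist m).jacobianWMap E.tateSubInvariant := by
  rw [Extension.tateSubInvariant, Extension.tateSubInvariant, ← Ext.pullbackMapW_mkOfW,
    Ext.tateSubEquivJacobianW_pullbackMapW]

omit [AddCommGroup VB] [Module ℚ VB] [FiniteDimensional ℚ VB] [AddCommGroup VB'] [Module ℚ VB']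
  [FiniteDimensional ℚ VB'] in
/-- A split extension of `A` by `ℚ(m)` pulls back to a split extension (invariant `(h^∨(m))_* 0 = 0`).
[cite: Carlson1980, §2(b) Prop. 1] -/
theorem Extension.isSplit_pullback_of_isSplit_tateSub (h : Hom A' A)
    (E : Extension A (tate m).toMixedHodgeStructure VE) (hE : E.IsSplit) : (E.pullback h).IsSplit := by
  rw [Extension.isSplit_iff_tateSubInvariant_eq_zero, Extension.tateSubInvariant_pullback,
    (E.isSplit_iff_tateSubInvariant_eq_zero).1 hE, map_zero]

omit [AddCommGroup VB] [Module ℚ VB] [FiniteDimensional ℚ VB] [AddCommGroup VB'] [Module ℚ VB']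
  [FiniteDimensional ℚ VB'] in
/-- If `h^∨(m)_*` kills the invariant of `E`, the pull-back `h^*E` splits (e.g. `h` factoring through a
sub-MHS on which `E` becomes trivial). [cite: Carlson1980, §2(b) Prop. 1] -/
theorem Extension.isSplit_pullback_of_jacobianWMap_eq_zero (h : Hom A' A)
    (E : Extension A (tate m).toMixedHodgeStructure VE)
    (h0 : ((h.transpose).tateTwist m).jacobianWMap E.tateSubInvariant = 0) : (E.pullback h).IsSplit := by
  rw [Extension.isSplit_iff_tateSubInvariant_eq_zero, Extension.tateSubInvariant_pullback, h0]

end TateSubNaturality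

end MixedHodgeStructure

end Literature.AlgebraicGeometry.Motives

end
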